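import Summits.RiemannHypothesis.RiemannHypothesis.Theses.WeilWindowFlow
import Literature.NumberTheory.LFunctions.WeilSmallSupportPositivity
import Literature.NumberTheory.LFunctions.WeilGroundState
import Literature.NumberTheory.LFunctions.WeilWindowSuzukiContinuityProofs
import Literature.NumberTheory.LFunctions.WeilDilationVirial

/-!
# Disproof of `WindowLipschitz` (crux stmt-RiemannHypothesis-1039, route WeilWindowFlow) — findings

Standing-adversary work file (refuter cdisprove seat, gen 1; cycle 1 2026-08-15/16). The crux is

  `WindowLipschitz : ∀ b₀ A, 0 < b₀ → b₀ ≤ A → ∃ L, ∀ b a, b₀ ≤ b → b ≤ a → a ≤ A → ε b - ε a ≤ L * (a - b)`,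

`ε = Literature.NumberTheory.LFunctions.weilGroundEnergy` (bottom of Weil's quadratic form on the
`L²`-unit sphere of smooth test functions supported in `[-a, a]`; a real `sInf`, junk-free for `a > 0`
by `exists_isWeilTest_sphere` + `bddBelow_weilQuadratic_sphere_holds`).

VERDICT SO FAR: NOT REFUTED — the statement resists every cheap attack and two independent numerics; it is
very probably TRUE (two prover lines are building it: `PICKED.md`). What IS proved here (sorry-free unless marked):

* § Basic API used by every attack: the sphere is nonempty, `ε` is antitone on `(0, ∞)`
  (`weilGroundEnergy_antitone`) and `ε(a) → +∞` as `a → 0⁺` in the quantitative form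
  `∀ M, ∃ a₀ > 0, ∀ a ∈ (0, a₀], M ≤ ε a` (`weilGroundEnergy_large_near_zero`, from
  `weilQuadratic_coercive`, Bombieri 2000 Thm 12).
* (a) LOAD-BEARING ANALYSIS. The floor `0 < b₀` is necessary: with `0 ≤ b₀` the statement is
  FALSE (`windowLipschitz_false_without_floor`), because `ε` is unbounded near `0` while `ε A` is a
  fixed real. The hypothesis `b₀ ≤ A` is decoration (`windowLipschitz_iff_without_hle`).
  The direction of the one-sided inequality is the whole content: the reverse one-sided bound holds
  with constant `0` (`reverse_oneSided_trivial`, antitonicity).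
* (b) TIGHTNESS. Any admissible constant obeys `L ≥ (ε b₀ - ε A)/(A - b₀)`
  (`lipschitzConstant_lower_bound`), hence `L(b₀, 1) → +∞` as `b₀ → 0⁺`
  (`lipschitzConstant_unbounded`): a proof must produce a constant that genuinely depends on `b₀`.
* (c) NATURAL STRENGTHENINGS REFUTED. One constant for all windows `0 < b ≤ a` is FALSE
  (`not_windowLipschitzUniform`).
* (d) REFORMULATIONS for provers: `WindowLipschitz ↔ ∀ b₀ A, 0 < b₀ → b₀ ≤ A → ∃ K, LipschitzOnWith K ε (Icc b₀ A)`
  (`windowLipschitz_iff_lipschitzOnWith`) and `WindowLipschitz ↔ LocallyLipschitzOn (Ioi 0) ε`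
  (`windowLipschitz_iff_locallyLipschitzOn`): the local-to-compact glue is free, work one window at a time.
* (e) NEAR-MISSES (the only `sorry`s of this file): `not_virialBoundedOnNearMinimisers` — the
  sublevel-set ("all near-minimisers") version of the Hadamard checkpoint is expected FALSE by a
  coherent wave-packet witness (docstring); i.e. a proof of the crux via Bombieri's dilation must use
  TRUE minimisers (attainment, now a tree theorem via CCM25 Thm 3.6) and their edge regularity, or a
  frequency-filtered selection of near-minimisers with edge-law-strength tail bounds.
* Targets: none yet (payload.stuck_stubs empty at gen 1; the picked line's open stubs `stub_supBound`,
  `stub_edgeLaw` and the borderline-barrier S-stubs were read and sanity-checked on paper — the barrier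
  SURPLUS sign/size `≈ (½…1)√log(1/d₀) − C(δ)` is right: the critical `½√log(1/d)` of the killing term cancels
  exactly against the inward pull; no cheap kill).
* § Literature: the sharp edge law is OPEN even for the Dirichlet logarithmic Laplacian alone —
  Feulefack–Jarohs–Weth (J. Fourier Anal. Appl. 2022 = arXiv:2010.10448), Remark 1.5 (read, p.5):
  eigenfunctions satisfy `|φ(x)| = O((-ln dist(x,Ωᶜ))^{-τ})` for all `τ ∈ (0, 1/2)`; Remark 1.2(iii):
  "the optimal rate of the uniform boundary [decay] remains open"; same paper p.6: `C²_c(Ω)` is dense in the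
  form domain `ℋ⁰₀(Ω)` (so smooth-inf = form-domain-inf here). Connes–Consani arXiv:2106.01715 §2.3–2.5 (read
  p.9–10; their `L = 2a`): p = 2 "first lowers the smallest eigenvalue in e^L ∈ (2, 2.27) but then saves it";
  bottom `< 6e-8` at `e^L = 3`, `log s(L)` linear in `e^L`. Bombieri 2000 p.12 (Problem 2 regularity left open),
  p.16–17 (Thm 5: continuity only). Search for a Hadamard formula for log-Laplacian-type operators: degraded
  (searchd/arXiv/OpenAlex/S2 down 2026-08-15/16), nothing found in galaxy/crossref.
* § Numerics. (N1) OWN quick run j004905 (uniform-mesh P0 Rayleigh–Ritz of the tree-normalised form with the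
  Bombieri archimedean kernel, N = 100/200, a ∈ [0.1, 1.4]): ε_N ≥ 0 on the Yoshida range (sanity ✓);
  ε_200(0.1, 0.15, 0.2, 0.25, 0.3, log2/2) = 0.4572, 0.2182, 0.0950, 0.0335, 0.0077, 0.00145 (Richardson ≈ 1.1e-3 at
  log2/2, Connes–Consani's ~1e-3 ✓); ε + log a is NOT constant but ≈ −2.17 + 3.3a (the 3.3a is the polar term
  2(∫g ch)², growing like 2·2a·shape); one-sided difference quotients bounded and decreasing in a
  (4.78@0.10 [grid 0.05], 2.46, 1.23, 0.52, 0.127@0.30, 0.02@0.35, ≤ 3e-3 beyond = discretisation floor);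
  p = 2 entry a = 0.3466: left/right quotients 0.0397/0.0390 at δ = 0.005 — NO kink, no vertical tangent; spectral
  gap 0.54 (a = 0.2), 0.215 (0.3), 0.072 (log2/2), then ≲ 5e-4 (numerically degenerate bottom cluster for a ≳ 0.45,
  where ε itself is below the discretisation floor: C–C report < 6e-8 at e^{2a} = 3); edge cells at a = 0.2:
  g = 0.441, 0.524, 0.577, 0.620, 0.659, 0.693 (h = 2e-3) — slower than any power law. Main run j005041 (N ≤ 4000,
  fine a-grid) still queued at 05:30Z; j005137 cancelled as redundant with (N2).
  (N2) INDEPENDENT CONFIRMATION by the crux ideator's graded-mesh job j005651 (`Numerics-r1-k1.md` in this crux dir;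
  Markov form P + 𝓔_a − M_a, cells down to 1e-9 a): ε_N(log2/2) = 1.40e-3/1.36e-3/1.35e-3; ε' CONTINUOUS through the
  p = 2 entry (log-corner, slopes −0.035…−0.040); NO vertical tangent on [0.15, 1.2]; edge law c²·log(1/d) FLAT over
  7 decades (exponent exactly 1/2 with a 1/log drift); edge-mass law m(h)² log(1/h)/h bounded; Hadamard ratio
  drop/h ÷ m² log(1/h)/h ≈ 0.90–0.92 window-independent (a log-Hadamard formula −ε'(a) = κ·(edge coefficient)² is
  numerically exact). The two discretisations (Bombieri kernel vs Markov form) agree on ε(log2/2) to 1e-4.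
* § New PROVED support lemmas (this seat, rc0, attached as item evidence; Literature targets pending a responsive
  gate): `Literature.Analysis.SpecialFunctions.reDigammaQuarter_dilate_sub_le` (0 ≤ ρ(ct) − ρ(t) ≤ 2(c²−1), uniform
  in t; file DigammaQuarterDilation.lean) and `WeilDilationSlope.lean`: along Bombieri's dilation competitors the
  archimedean part of Re Q(g_η) − Re Q(g) lies in [0, 2((1+η)²−1)‖g‖²] and the polar part is ≤ η·8a(1+a)e^a‖g‖² for
  EVERY test g, while the prime part is EXACTLY Σ_{n≤e^{2a}} Λ(n)n^{-1/2}(D_{log n}(g) − D_{(1+η)log n}(g))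
  (D_t(g) = ‖g(·+t) − g‖²); hence the slope inequality
  ε(a/(1+η)) − Re Q(g) ≤ η·8a(1+a)e^a + 2((1+η)²−1) + Σ Λ(n)n^{-1/2}(D_{(1+η)log n}(g) − D_{log n}(g)).
  In the squeeze gauge the ONLY possible non-Lipschitz source is thus the right-regularity of t ↦ D_t(g) at the points
  log n for near-minimisers; by (e) it fails for SOME near-minimisers, so a selection (true ground states) is needed —
  the picked line `cut-dont-squeeze` avoids the squeeze gauge altogether, consistently with (e).

§ Why it resists: continuity of `ε` on `(0,∞)` is a tree theorem (`Suzuki2026_thm_1_3_holds`), so no jump; the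
archimedean part is `½ ×` the 1-D Dirichlet LOGARITHMIC Laplacian plus a compact perturbation, whose bottom is
real-analytic in the window by exact scaling, and its dilation slope is Lipschitz for every test function (proved,
above); prime powers enter SOFTLY at `a = (log n)/2` (gain `≲ Λ(n) n^{-1/2}·(edge mass)²`, edge concentration costs
`log(1/η)` per unit mass; numerics: ε' continuous there); a genuine counterexample would need ground states whose
increment function `D_t` fails to be right-Lipschitz at some `log n`, or edge mass `m(h)² ≫ h/log(1/h)` — both
excluded by the `(log 1/d)^{-1/2}` edge law that the numerics show over 7 decades and that the leads are proving.
-/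

noncomputable section

-- `Summit.<S>.<S>.…` duplicates `RiemannHypothesis` by design (D-0017); the Summits library sets
-- `weak.linter.dupNamespace = false` in the lakefile, repeated here for standalone checks of this work file.
set_option linter.dupNamespace false

namespace Summit.RiemannHypothesis.RiemannHypothesis.Cruxes.WindowLipschitz.Disproof

open Set MeasureTheory
open Literature.NumberTheory.LFunctions
open Summit.RiemannHypothesis.RiemannHypothesis.Theses.WeilWindowFlow (WindowLipschitz)

/-! ## Basic API: non-emptiness, antitonicity, blow-up at `0⁺` -/

/-- The unit sphere of the window `a > 0` is nonempty (as a set of values of `Re Q`). [folklore] -/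
theorem sphere_nonempty {a : ℝ} (ha : 0 < a) :
    {x : ℝ | ∃ g : ℝ → ℂ, IsWeilTest g ∧ tsupport g ⊆ Icc (-a) a ∧
      ∫ t : ℝ, ‖g t‖ ^ 2 = 1 ∧ x = (weilQuadratic g).re}.Nonempty := by
  obtain ⟨g, hg, hsupp, hnorm⟩ := exists_isWeilTest_sphere ha
  exact ⟨_, g, hg, hsupp, hnorm, rfl⟩

/-- `ε` is antitone on `(0, ∞)`: a larger window has more test functions. [folklore] -/
theorem weilGroundEnergy_antitone {b a : ℝ} (hb : 0 < b) (hba : b ≤ a) :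
    weilGroundEnergy a ≤ weilGroundEnergy b := by
  unfold weilGroundEnergy
  refine csInf_le_csInf (bddBelow_weilQuadratic_sphere_holds a) (sphere_nonempty hb) ?_
  rintro x ⟨g, hg, hsupp, hnorm, rfl⟩
  exact ⟨g, hg, hsupp.trans (Icc_subset_Icc (neg_le_neg hba) hba), hnorm, rfl⟩

/-- Coercivity in `sInf` form: `ε(a) ≥ M` on all sufficiently small windows (Bombieri 2000 Thm 12,
tree theorem `weilQuadratic_coercive`, plus non-emptiness of the sphere). [cite: Bombieri2000Weil, Thm 12] -/
theorem weilGroundEnergy_large_near_zero (M : ℝ) :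
    ∃ a₀ : ℝ, 0 < a₀ ∧ ∀ a : ℝ, 0 < a → a ≤ a₀ → M ≤ weilGroundEnergy a := by
  obtain ⟨a₀, ha₀, H⟩ := weilQuadratic_coercive M
  refine ⟨a₀, ha₀, fun a ha hle ↦ ?_⟩
  refine le_csInf (sphere_nonempty ha) ?_
  rintro x ⟨g, hg, hsupp, hnorm, rfl⟩
  have h := H a ha hle g hg hsupp
  rwa [hnorm, mul_one] at h

/-! ## (a) Load-bearing analysis -/

/-- `WindowLipschitz` with the floor hypothesis weakened from `0 < b₀` to `0 ≤ b₀`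
(windows down to `0` allowed). -/
def WindowLipschitzWithoutFloor : Prop :=
  ∀ b₀ A : ℝ, 0 ≤ b₀ → b₀ ≤ A → ∃ L : ℝ, ∀ b a : ℝ, b₀ ≤ b → b ≤ a → a ≤ A →
    weilGroundEnergy b - weilGroundEnergy a ≤ L * (a - b)

/-- ANY PROOF MUST USE `0 < b₀`: with `b₀ = 0` the one-sided Lipschitz bound fails, since
`ε(b) → +∞` as `b → 0⁺` (coercivity) while `ε(1)` is a fixed real number and `a - b ≤ 1`.
Witness: `b₀ = 0`, `A = 1`, `b = min a₀ 1` with `a₀` from `weilGroundEnergy_large_near_zero (ε 1 + |L| + 1)`. [folklore] -/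
theorem windowLipschitz_false_without_floor : ¬ WindowLipschitzWithoutFloor := by
  intro h
  obtain ⟨L, hL⟩ := h 0 1 le_rfl zero_le_one
  obtain ⟨a₀, ha₀, H⟩ := weilGroundEnergy_large_near_zero (weilGroundEnergy 1 + |L| + 1)
  have hb0 : 0 < min a₀ 1 := lt_min ha₀ one_pos
  have hb1 : min a₀ 1 ≤ 1 := min_le_right _ _
  have h1 := hL (min a₀ 1) 1 hb0.le hb1 le_rfl
  have h2 := H (min a₀ 1) hb0 (min_le_left _ _)
  have h3 : L * (1 - min a₀ 1) ≤ |L| := by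
    have h4 : L * (1 - min a₀ 1) ≤ |L| * (1 - min a₀ 1) :=
      mul_le_mul_of_nonneg_right (le_abs_self L) (by linarith)
    have h5 : |L| * (1 - min a₀ 1) ≤ |L| * 1 :=
      mul_le_mul_of_nonneg_left (by linarith) (abs_nonneg L)
    linarith
  linarith

/-- The hypothesis `b₀ ≤ A` is decoration: for `A < b₀` the inner statement is vacuous. [folklore] -/
theorem windowLipschitz_iff_without_hle :
    WindowLipschitz ↔
      ∀ b₀ A : ℝ, 0 < b₀ → ∃ L : ℝ, ∀ b a : ℝ, b₀ ≤ b → b ≤ a → a ≤ A →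
        weilGroundEnergy b - weilGroundEnergy a ≤ L * (a - b) := by
  constructor
  · intro h b₀ A hb₀
    by_cases hle : b₀ ≤ A
    · exact h b₀ A hb₀ hle
    · exact ⟨0, fun b a hb hba haA ↦ absurd (hb.trans (hba.trans haA)) hle⟩
  · intro h b₀ A hb₀ _
    exact h b₀ A hb₀

/-- The REVERSE one-sided inequality is free (constant `0`) by antitonicity — the content of the crux
is entirely in the stated direction. [folklore] -/
theorem reverse_oneSided_trivial {b a : ℝ} (hb : 0 < b) (hba : b ≤ a) :
    weilGroundEnergy a - weilGroundEnergy b ≤ 0 * (a - b) := by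
  have := weilGroundEnergy_antitone hb hba
  linarith

/-! ## (b) Tightness: admissible constants blow up as `b₀ → 0⁺` -/

/-- Any admissible constant on `[b₀, A]` is at least the chord slope `(ε b₀ - ε A)/(A - b₀)`. [folklore] -/
theorem lipschitzConstant_lower_bound {b₀ A L : ℝ} (hlt : b₀ < A)
    (hL : ∀ b a : ℝ, b₀ ≤ b → b ≤ a → a ≤ A →
      weilGroundEnergy b - weilGroundEnergy a ≤ L * (a - b)) :
    (weilGroundEnergy b₀ - weilGroundEnergy A) / (A - b₀) ≤ L := by
  rw [div_le_iff₀ (sub_pos.2 hlt)]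
  exact hL b₀ A le_rfl hlt.le le_rfl

/-- The Lipschitz constant of `ε` on `[b₀, 1]` is NOT bounded as `b₀ → 0⁺`: for every `K` there is a
window floor `b₀ ∈ (0, 1)` below which every admissible constant exceeds `K`. [folklore] -/
theorem lipschitzConstant_unbounded (K : ℝ) :
    ∃ b₀ : ℝ, 0 < b₀ ∧ b₀ < 1 ∧ ∀ L : ℝ,
      (∀ b a : ℝ, b₀ ≤ b → b ≤ a → a ≤ 1 →
        weilGroundEnergy b - weilGroundEnergy a ≤ L * (a - b)) → K ≤ L := by
  obtain ⟨a₀, ha₀, H⟩ := weilGroundEnergy_large_near_zero (weilGroundEnergy 1 + max K 0)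
  have hb0 : 0 < min a₀ (1 / 2) := lt_min ha₀ (by norm_num)
  have hb1 : min a₀ (1 / 2) ≤ 1 / 2 := min_le_right _ _
  refine ⟨min a₀ (1 / 2), hb0, by linarith, fun L hL ↦ ?_⟩
  have h1 := hL (min a₀ (1 / 2)) 1 le_rfl (by linarith) le_rfl
  have h2 := H (min a₀ (1 / 2)) hb0 (min_le_left _ _)
  have hK : K ≤ max K 0 := le_max_left _ _
  have h0 : 0 ≤ max K 0 := le_max_right _ _
  rcases le_or_gt 0 L with hL0 | hL0
  · have h3 : L * (1 - min a₀ (1 / 2)) ≤ L * 1 :=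
      mul_le_mul_of_nonneg_left (by linarith) hL0
    linarith
  · have h3 : L * (1 - min a₀ (1 / 2)) < 0 := mul_neg_of_neg_of_pos hL0 (by linarith)
    linarith

/-! ## (c) Natural strengthenings refuted -/

/-- One-sided Lipschitz with ONE constant on the whole half-line `0 < b ≤ a`. -/
def WindowLipschitzUniform : Prop :=
  ∃ L : ℝ, ∀ b a : ℝ, 0 < b → b ≤ a →
    weilGroundEnergy b - weilGroundEnergy a ≤ L * (a - b)

/-- The uniform strengthening is FALSE (same witness as `windowLipschitz_false_without_floor`:
blow-up of `ε` at `0⁺` against bounded increments `a - b ≤ 1`). [folklore] -/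
theorem not_windowLipschitzUniform : ¬ WindowLipschitzUniform := by
  rintro ⟨L, hL⟩
  obtain ⟨a₀, ha₀, H⟩ := weilGroundEnergy_large_near_zero (weilGroundEnergy 1 + |L| + 1)
  have hb0 : 0 < min a₀ 1 := lt_min ha₀ one_pos
  have hb1 : min a₀ 1 ≤ 1 := min_le_right _ _
  have h1 := hL (min a₀ 1) 1 hb0 hb1
  have h2 := H (min a₀ 1) hb0 (min_le_left _ _)
  have h3 : L * (1 - min a₀ 1) ≤ |L| := by
    have h4 : L * (1 - min a₀ 1) ≤ |L| * (1 - min a₀ 1) :=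
      mul_le_mul_of_nonneg_right (le_abs_self L) (by linarith)
    have h5 : |L| * (1 - min a₀ 1) ≤ |L| * 1 :=
      mul_le_mul_of_nonneg_left (by linarith) (abs_nonneg L)
    linarith
  linarith

/-! ## (d) Reformulation: Mathlib's `LipschitzOnWith` -/

/-- `WindowLipschitz` is exactly local Lipschitz continuity of `ε` on compact sub-intervals of
`(0, ∞)` in Mathlib's sense (antitonicity turns the one-sided bound into a two-sided one). [folklore] -/
theorem windowLipschitz_iff_lipschitzOnWith :
    WindowLipschitz ↔
      ∀ b₀ A : ℝ, 0 < b₀ → b₀ ≤ A → ∃ K : NNReal, LipschitzOnWith K weilGroundEnergy (Icc b₀ A) := by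
  constructor
  · intro h b₀ A hb₀ hle
    obtain ⟨L, hL⟩ := h b₀ A hb₀ hle
    refine ⟨Real.toNNReal L, LipschitzOnWith.of_dist_le' fun x hx y hy ↦ ?_⟩
    rcases le_total x y with hxy | hxy
    · have h1 := hL x y hx.1 hxy hy.2
      have h2 := weilGroundEnergy_antitone (hb₀.trans_le hx.1) hxy
      rw [Real.dist_eq, Real.dist_eq, abs_of_nonneg (by linarith), abs_of_nonpos (by linarith)]
      linarith
    · have h1 := hL y x hy.1 hxy hx.2
      have h2 := weilGroundEnergy_antitone (hb₀.trans_le hy.1) hxy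
      rw [Real.dist_eq, Real.dist_eq, abs_of_nonpos (by linarith), abs_of_nonneg (by linarith)]
      linarith
  · intro h b₀ A hb₀ hle
    obtain ⟨K, hK⟩ := h b₀ A hb₀ hle
    refine ⟨K, fun b a hb hba haA ↦ ?_⟩
    have hbm : b ∈ Icc b₀ A := ⟨hb, hba.trans haA⟩
    have ham : a ∈ Icc b₀ A := ⟨hb.trans hba, haA⟩
    have h1 := hK.dist_le_mul b hbm a ham
    rw [Real.dist_eq, Real.dist_eq, abs_sub_comm b a,
      abs_of_nonneg (show (0 : ℝ) ≤ a - b by linarith)] at h1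
    exact (le_abs_self _).trans h1


/-- `WindowLipschitz` is EXACTLY "`ε` is locally Lipschitz on `(0, ∞)`" (Mathlib `LocallyLipschitzOn`):
the passage from local one-sided bounds near each window to a uniform constant on `[b₀, A]` is free
(`LocallyLipschitzOn.exists_lipschitzOnWith_of_compact`). So a prover may work one window at a time. [folklore] -/
theorem windowLipschitz_iff_locallyLipschitzOn :
    WindowLipschitz ↔ LocallyLipschitzOn (Ioi (0 : ℝ)) weilGroundEnergy := by
  rw [windowLipschitz_iff_lipschitzOnWith]
  constructor
  · intro h x hx
    have hx0 : (0 : ℝ) < x := hx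
    obtain ⟨K, hK⟩ := h (x / 2) (2 * x) (by linarith) (by linarith)
    refine ⟨K, Icc (x / 2) (2 * x), ?_, hK⟩
    apply mem_nhdsWithin_of_mem_nhds
    exact Icc_mem_nhds (by linarith) (by linarith)
  · intro h b₀ A hb₀ hle
    have hsub : Icc b₀ A ⊆ Ioi (0 : ℝ) := fun x hx ↦ hb₀.trans_le hx.1
    exact (h.mono hsub).exists_lipschitzOnWith_of_compact isCompact_Icc

/-! ## (e) Near-misses / documented open reductions (the ONLY `sorry`s of this work file)

The Hadamard route to the crux (Bombieri 2000 Thm 5; tree: `weilDilate`, `weilDilationVirial`,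
`weilQuadratic_weilDilate`): for a normalised (near-)minimiser `φ` of the window `a`,
`ε(a/(1+η)) ≤ Re Q(weilDilate η φ) = ε(a) + η · weilDilationVirial φ + o(η)` (`η → 0⁺`), so a bound
`weilDilationVirial φ ≤ L a` uniform over the relevant `φ` and over `a ∈ [b₀, A]` gives the one-sided
Lipschitz bound. WHICH `φ`? The statement below says: NOT all energy-near-minimisers. -/

/-- The sublevel-set ("all near-minimisers") version of the Hadamard checkpoint: the dilation
virial is bounded above on every normalised test function whose energy is within `δ` of the bottom,
uniformly for windows in `[b₀, A]`. -/
def VirialBoundedOnNearMinimisers : Prop :=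
  ∀ b₀ A : ℝ, 0 < b₀ → b₀ ≤ A → ∃ L δ : ℝ, 0 < δ ∧ ∀ a : ℝ, b₀ ≤ a → a ≤ A →
    ∀ g : ℝ → ℂ, IsWeilTest g → tsupport g ⊆ Icc (-a) a → ∫ t : ℝ, ‖g t‖ ^ 2 = 1 →
      (weilQuadratic g).re ≤ weilGroundEnergy a + δ → weilDilationVirial g ≤ L

/-- NEAR-MISS (expected refutation, not yet formalised): `VirialBoundedOnNearMinimisers` should be
FALSE. Witness sketch: fix a window `a ∈ (log 2 / 2, A]` (so the prime `2` is inside), a SMOOTH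
normalised near-minimiser `φ` with `Re Q(φ) ≤ ε(a) + δ/2` (exists by definition of the `sInf`), a
smooth real bump `w` with `supp w ∪ (supp w + log 2) ⊆ (-a, a)`, and perturb by two coherent wave
packets `ψ_N(u) = μ^{1/2} (w(u) + w(u - log 2)) cos(N u)`, `μ = c δ / log N`. Then
(i) energy: `Q(ψ_N) ≍ μ log N ‖w‖² = O(δ)` (archimedean weight `Re ψ(1/4+it/2) = log(1+|t|) + O(1)`,
tree `DigammaVerticalAsymptotics`), cross term `2 Re B(φ, ψ_N) → 0` (`N → ∞`, Riemann–Lebesgue for the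
smooth `Tφ`), `‖φ + ψ_N‖² = 1 + O(μ)`: the renormalised `φ + ψ_N` stays within `O(δ)` of the bottom;
(ii) virial: its prime part is `-2 Σ Λ(n) n^{-1/2} log n · Re k'(log n)` and for `k_ψ = ψ_N ⋆ ψ̃_N`,
`Re k'_ψ(log 2) = ∓ (μ N / 2) sin(N log 2) (w ⋆ w̃)(0) + O(μ)`, while the archimedean and polar parts of
the virial of `ψ_N` are `O(μ)` (`|t · d/dt Re ψ(1/4+it/2)|` bounded) and the cross virial `B_V(φ, ψ_N)`
is bounded; choosing `N` along `sin(N log 2) → -1` gives `weilDilationVirial (φ+ψ_N)/‖·‖² ≳ μ N =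
c δ N / log N → +∞`. CONSEQUENCE for provers: the dilation route must use TRUE minimisers (attainment,
Bombieri 2000 Thm 3, and their Euler–Lagrange edge regularity) or frequency-FILTERED near-minimisers
with a tail bound `∫_{|ξ|>Λ} |φ̂|² ≲ 1/(Λ log Λ)` (edge-law strength); energy-boundedness alone yields only
the `1/√(log(1/h))` modulus of `WeilWindowSuzukiContinuityProofs`. Missing for a Lean proof: an
archimedean-energy upper bound for modulated bumps and the bilinear expansion of `weilDilationVirial`. -/
theorem not_virialBoundedOnNearMinimisers : ¬ VirialBoundedOnNearMinimisers := by
  sorry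

end Summit.RiemannHypothesis.RiemannHypothesis.Cruxes.WindowLipschitz.Disproof

end
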